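import Mathlib.Algebra.BigOperators.Ring.Finset
import Mathlib.Algebra.Module.Submodule.Basic
import Mathlib.RingTheory.Ideal.Basic
import Mathlib.Data.Finset.Powerset
import HarnessLib

/-!
# Kolyvagin derivatives of two group-ring Euler systems with the same primitive parts and
# "alternate" Euler factors agree: the exact expansion (pure commutative algebra)
# (cell `b2b-bsdres`, team n1011, ROUTE-1 PORT anatomy (P-KIM); R1-71 = Q-K (r1 GEN 43, ERRATUM
# E-55a): PK-4b `KatoZetaValueDerivativeCongruence`, abstract core PK-4b-A; seat p15 GEN 9)

HONEST FRAMING (cell `b2b-bsdres`, run/shared/lean/b2b/bsd-rank1-residual/, verbatim in every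
file): the goal of the cell is to DELETE the COMBINATION-SHAPED residual classes of the
Birch–Swinnerton-Dyer formula for ALL analytic-rank `≤ 1` elliptic curves over `ℚ` — "full BSD
formula for every rank `≤ 1` curve in class `C`" assembled STRICTLY from published theorems — so
that the rank-`≤ 1` remainder becomes exactly the CONSTRUCTION-SHAPED classes, which are TYPED
(missing-input `Prop`s), NOT attempted. This is not "finishing BSD". Team n1011 (N10/N11; ROUTE 1,
the PORT anatomy (P-KIM) of class X4 ∧ `p = 3`): research route on CONSTRUCTION-SHAPED classes;
prove what is provable now; no claim beyond stated classes; census output = EVIDENCE, never a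
Literature fact; RESIDUAL-MAP marks UNCHANGED; nothing is booked by this file. TOOL THEOREMS ONLY:
no definition, no named fact, no instance, no `sorry`.

## What (the located step R1-71, in the abstract)

Kato's value `x_{0,r} ∈ ℚ(ζ_n)` (`ZetaBody` C5) and the Mazur–Tate element `θ̃_f(n)` carry DIFFERENT
Euler factors at the primes `ℓ ∣ n` on their imprimitive character components (`K_ℓ = 1 − a_ℓℓ⁻¹σ_ℓ⁻¹
+ ℓ⁻¹σ_ℓ⁻²` vs `M_ℓ = a_ℓ − σ_ℓ − σ_ℓ⁻¹`, Rubin's "alternate Euler factors"); they agree on the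
TOTALLY PRIMITIVE components only. This file is the commutative-algebra core of the comparison of
their Kolyvagin derivatives. Setting: a commutative ring `S` (the group ring `ℚ[G_n]` in the
application), indices `ι` (the primes of `n`), and for each `i`: a "norm" `N i` and a "derivative"
`D i` in `S` with `N i * N i = ν i • N i` (`ν i = #G_i`) and `D i * N i = τ i • N i`
(`τ i = ν i (ν i − 1)/2`), units `ν i` of `S` and the scalars `g i = τ i / ν i`; the REDUCED derivative
is `D̃ i = D i − g i • N i`, which kills `N i` (`reducedDeriv_mul_norm`). Two families
`X Y : Finset ι → S` ("Kato", "Mazur–Tate") with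
* (P) the same primitive parts: `(∏_{i∈d} (ν i − N i)) * (X d − Y d) = 0`, and
* (L) level lowering through the norms: `N_U * X d = PX U d * X (d \ U)`, likewise `Y`/`PY`, for every
  `U ⊆ d` (the product of the Euler factors along `U` against the family one level down; in the
  application the lower-level elements are embedded into the top-level group ring as NORM multiples,
  `X (d \ U) ∈ N_U · S`, so no `N_U` is repeated on the right — the older form
  `N_U X d = N_U (PX′ U d · X (d∖U))` is the case `PX U d := N_U PX′ U d`).
THEN (`prod_deriv_mul_sub_eq_sum`): **`D_d * (X d − Y d) = Σ_{∅ ≠ U ⊆ d} g_U • D̃_{d∖U} * ((PX U d − PY U d) * Y (d \ U))`**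
— every term carries the DIFFERENCE of the Euler factors (augmentation `≡ 0` at Kolyvagin primes on
both sides) against the modular family one level down; the `Δ(d∖U)`-terms die because `D̃` kills the
non-primitive parts (`prod_reducedDeriv_mul_sub_eq_zero`). The corollary `prod_deriv_mul_sub_mem`
reads it in any additive subgroup `I` (the application: `I = 3^{k+1}·ℤ₍₃₎[G_n]`; there the
`n`-normalised Kato factor on an imprimitive component is `a_ℓ − χ₀(ℓ) − ℓχ̄₀(ℓ)` against the modular
`a_ℓ − χ₀(ℓ) − χ̄₀(ℓ)`, so `PX_ℓ − PY_ℓ = (1 − ℓ)σ` ON THE NOSE and each term lies in `I` by the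
`3`-integrality of the modular family alone, `ℓ ≡ 1 (mod 3^{k+1})` being the Kolyvagin condition).
The single-prime case is `deriv_mul_sub_eq_single` (`D (X−Y) = g • (PX − PY) Y(∅)`-shape: r1's
check of R1-71 (i)).
HONEST LIMITS: pure algebra; no group ring, no character, no Kato object, no congruence is asserted here;
the instantiation (PK-4b-C, after PK-4a) supplies (P) from `ZetaBody` C5 + Birch + F-A and (L) from F-B /
PK-L; closes nothing.

References: K. Rubin, *Euler Systems* (2000) §9.6 "Varying the Euler factors"; B. Mazur, K. Rubin,
Mem. AMS 799 (2004) App. A; C.-H. Kim, arXiv:2203.12159 proof of Thm. 3.13 (→ [KKS]); r1 ROUTE-1 §55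
R1-71 / ERRATUM E-55a (cells/n1011/ROUTE-1.md).
-/

namespace Summit.BirchSwinnertonDyer.Rank1Residual.GaloisImage

namespace EulerFactorComparison

open Finset
open scoped BigOperators

variable {S : Type*} [CommRing S] {ι : Type*} [DecidableEq ι]
variable (N D : ι → S) (ν τ g : ι → S)

/-! ### §1 Norms, derivatives, reduced derivatives -/

omit [DecidableEq ι] in
/-- The reduced derivative `D̃_i = D_i − g_i N_i` kills the norm when `g_i ν_i = τ_i`:
`(D_i − g_i N_i) N_i = τ_i N_i − g_i ν_i N_i = 0`. [folklore] -/
theorem reducedDeriv_mul_norm {i : ι} (hNN : N i * N i = ν i * N i) (hDN : D i * N i = τ i * N i)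
    (hg : g i * ν i = τ i) : (D i - g i * N i) * N i = 0 := by
  rw [sub_mul, hDN, mul_assoc, hNN, ← mul_assoc, hg, sub_self]

omit [DecidableEq ι] in
/-- `D_i = D̃_i + g_i N_i`. [folklore] -/
theorem deriv_eq_reducedDeriv_add (i : ι) : D i = (D i - g i * N i) + g i * N i := by ring

/-- **Expansion of the full derivative**: `∏_{i∈d} D_i = Σ_{U ⊆ d} (∏_{i∈U} g_i N_i) · ∏_{i∈d∖U} D̃_i`.
[folklore] -/
theorem prod_deriv_eq_sum_powerset (d : Finset ι) :
    ∏ i ∈ d, D i =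
      ∑ U ∈ d.powerset, (∏ i ∈ U, g i * N i) * ∏ i ∈ d \ U, (D i - g i * N i) := by
  have h : ∏ i ∈ d, D i = ∏ i ∈ d, (g i * N i + (D i - g i * N i)) :=
    Finset.prod_congr rfl fun i _ => by ring
  rw [h, Finset.prod_add]

/-- A product of reduced derivatives over `e` kills anything of the form `N_i * Z` with `i ∈ e`.
[folklore] -/
theorem prod_reducedDeriv_mul_norm_mul_eq_zero (hNN : ∀ i, N i * N i = ν i * N i)
    (hDN : ∀ i, D i * N i = τ i * N i) (hg : ∀ i, g i * ν i = τ i) {e : Finset ι} {i : ι}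
    (hi : i ∈ e) (Z : S) : (∏ j ∈ e, (D j - g j * N j)) * (N i * Z) = 0 := by
  rw [← Finset.mul_prod_erase e _ hi, mul_comm (D i - g i * N i), mul_assoc,
    ← mul_assoc (D i - g i * N i), reducedDeriv_mul_norm N D ν τ g (hNN i) (hDN i) (hg i),
    zero_mul, mul_zero]

omit [DecidableEq ι] in
/-- `ν_i D̃_i = D_i (ν_i − N_i)`: the reduced derivative is the derivative composed with the
(scaled) primitive projector. [folklore] -/
theorem smul_reducedDeriv_eq {i : ι} (hDN : D i * N i = τ i * N i) (hg : g i * ν i = τ i) :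
    ν i * (D i - g i * N i) = D i * (ν i - N i) := by
  rw [mul_sub, mul_sub, hDN, ← hg]
  ring

omit [DecidableEq ι] in
/-- Hence `(∏_{i∈e} ν_i) · ∏_{i∈e} D̃_i = (∏ D_i) · ∏ (ν_i − N_i)`. [folklore] -/
theorem prod_smul_prod_reducedDeriv_eq (hDN : ∀ i, D i * N i = τ i * N i)
    (hg : ∀ i, g i * ν i = τ i) (e : Finset ι) :
    (∏ i ∈ e, ν i) * ∏ i ∈ e, (D i - g i * N i) = (∏ i ∈ e, D i) * ∏ i ∈ e, (ν i - N i) := by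
  rw [← Finset.prod_mul_distrib, ← Finset.prod_mul_distrib]
  exact Finset.prod_congr rfl fun i _ => smul_reducedDeriv_eq N D ν τ g (hDN i) (hg i)

omit [DecidableEq ι] in
/-- **`D̃_e` kills every element with vanishing totally-primitive part**: if the `ν_i` are units and
`(∏_{i∈e} (ν_i − N_i)) Δ = 0` then `(∏_{i∈e} D̃_i) Δ = 0`. [folklore] -/
theorem prod_reducedDeriv_mul_eq_zero_of_prim (hDN : ∀ i, D i * N i = τ i * N i)
    (hg : ∀ i, g i * ν i = τ i) (hν : ∀ i, IsUnit (ν i)) {e : Finset ι} {Δ : S}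
    (hP : (∏ i ∈ e, (ν i - N i)) * Δ = 0) : (∏ i ∈ e, (D i - g i * N i)) * Δ = 0 := by
  have hu : IsUnit (∏ i ∈ e, ν i) := IsUnit.prod_iff.mpr fun i _ => hν i
  refine hu.mul_left_cancel ?_
  rw [mul_zero, ← mul_assoc, prod_smul_prod_reducedDeriv_eq N D ν τ g hDN hg, mul_assoc, hP, mul_zero]

/-! ### §2 Two families with the same primitive parts and alternate Euler factors -/

variable (X Y : Finset ι → S) (PX PY : Finset ι → Finset ι → S)

/-- **THE EXPANSION (exact).** For two families `X, Y : Finset ι → S` with the same totally primitive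
part at every level (`hP`) and level-lowering laws through the norms with Euler-factor products
`PX U d`, `PY U d` against the families one level down (`hLX`, `hLY`):
`(∏_{i∈d} D_i) (X d − Y d) = Σ_{U ⊆ d, U ≠ ∅} (∏_{i∈U} g_i) · (∏_{i∈d∖U} D̃_i) · ((PX U d − PY U d) · Y (d ∖ U))`.
[folklore] -/
theorem prod_deriv_mul_sub_eq_sum (hDN : ∀ i, D i * N i = τ i * N i) (hg : ∀ i, g i * ν i = τ i) (hν : ∀ i, IsUnit (ν i))
    (hP : ∀ e : Finset ι, (∏ i ∈ e, (ν i - N i)) * (X e - Y e) = 0)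
    (hLX : ∀ d U : Finset ι, U ⊆ d → (∏ i ∈ U, N i) * X d = PX U d * X (d \ U))
    (hLY : ∀ d U : Finset ι, U ⊆ d → (∏ i ∈ U, N i) * Y d = PY U d * Y (d \ U))
    (d : Finset ι) :
    (∏ i ∈ d, D i) * (X d - Y d) =
      ∑ U ∈ d.powerset.erase ∅, (∏ i ∈ U, g i) *
        ((∏ i ∈ d \ U, (D i - g i * N i)) * ((PX U d - PY U d) * Y (d \ U))) := by
  rw [prod_deriv_eq_sum_powerset N D g d, Finset.sum_mul]
  rw [← Finset.sum_erase_add _ _ (Finset.empty_mem_powerset d)]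
  -- the `U = ∅` term: `D̃_d Δ(d) = 0`
  have h0 : (∏ i ∈ (∅ : Finset ι), g i * N i) * (∏ i ∈ d \ ∅, (D i - g i * N i)) * (X d - Y d) = 0 := by
    rw [Finset.prod_empty, one_mul, Finset.sdiff_empty]
    exact prod_reducedDeriv_mul_eq_zero_of_prim N D ν τ g hDN hg hν (hP d)
  rw [h0, add_zero]
  refine Finset.sum_congr rfl fun U hU => ?_
  have hUd : U ⊆ d := Finset.mem_powerset.mp (Finset.mem_of_mem_erase hU)
  -- split `∏_{i∈U} g_i N_i = (∏ g_i) (∏ N_i)` and lower both families along `U`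
  have hsplit : ∏ i ∈ U, g i * N i = (∏ i ∈ U, g i) * ∏ i ∈ U, N i := Finset.prod_mul_distrib
  have hNΔ : (∏ i ∈ U, N i) * (X d - Y d) =
      (PX U d - PY U d) * Y (d \ U) + PX U d * (X (d \ U) - Y (d \ U)) := by
    rw [mul_sub, hLX d U hUd, hLY d U hUd]
    ring
  -- the `Δ(d ∖ U)` term dies under `D̃_{d∖U}`
  have hkill : (∏ i ∈ d \ U, (D i - g i * N i)) * (PX U d * (X (d \ U) - Y (d \ U))) = 0 := by
    rw [mul_left_comm, prod_reducedDeriv_mul_eq_zero_of_prim N D ν τ g hDN hg hν (hP (d \ U)),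
      mul_zero]
  calc (∏ i ∈ U, g i * N i) * (∏ i ∈ d \ U, (D i - g i * N i)) * (X d - Y d)
      = (∏ i ∈ U, g i) * (∏ i ∈ d \ U, (D i - g i * N i)) * ((∏ i ∈ U, N i) * (X d - Y d)) := by
        rw [hsplit]; ring
    _ = (∏ i ∈ U, g i) * (∏ i ∈ d \ U, (D i - g i * N i)) *
          ((PX U d - PY U d) * Y (d \ U) + PX U d * (X (d \ U) - Y (d \ U))) := by
        rw [hNΔ]
    _ = (∏ i ∈ U, g i) * ((∏ i ∈ d \ U, (D i - g i * N i)) * ((PX U d - PY U d) * Y (d \ U))) +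
          (∏ i ∈ U, g i) *
            ((∏ i ∈ d \ U, (D i - g i * N i)) * (PX U d * (X (d \ U) - Y (d \ U)))) := by
        ring
    _ = (∏ i ∈ U, g i) * ((∏ i ∈ d \ U, (D i - g i * N i)) * ((PX U d - PY U d) * Y (d \ U))) := by
        rw [hkill, mul_zero, add_zero]

/-- **Corollary (divisibility bookkeeping).** If every term of the expansion lies in an additive
subgroup `I` of `S` (in the application: `3^{k+1}`-multiples of `3`-integral elements — each
`PX U d − PY U d` is a multiple of some `ℓ − 1`, `ℓ ∈ U` a Kolyvagin prime, and the modular family is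
`3`-integral), then so does `D_d (X d − Y d)`. [folklore] -/
theorem prod_deriv_mul_sub_mem (hDN : ∀ i, D i * N i = τ i * N i) (hg : ∀ i, g i * ν i = τ i) (hν : ∀ i, IsUnit (ν i))
    (hP : ∀ e : Finset ι, (∏ i ∈ e, (ν i - N i)) * (X e - Y e) = 0)
    (hLX : ∀ d U : Finset ι, U ⊆ d → (∏ i ∈ U, N i) * X d = PX U d * X (d \ U))
    (hLY : ∀ d U : Finset ι, U ⊆ d → (∏ i ∈ U, N i) * Y d = PY U d * Y (d \ U))
    (I : AddSubgroup S) (d : Finset ι)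
    (hI : ∀ U ∈ d.powerset.erase ∅, (∏ i ∈ U, g i) *
        ((∏ i ∈ d \ U, (D i - g i * N i)) * ((PX U d - PY U d) * Y (d \ U))) ∈ I) :
    (∏ i ∈ d, D i) * (X d - Y d) ∈ I := by
  rw [prod_deriv_mul_sub_eq_sum N D ν τ g X Y PX PY hDN hg hν hP hLX hLY d]
  exact sum_mem hI

/-- **The single-prime case** (r1's check of R1-71 (i)): with one index `i`, `d = {i}`:
`D_i (X {i} − Y {i}) = g_i ((PX {i} {i} − PY {i} {i}) · Y ∅)`. [folklore] -/
theorem deriv_mul_sub_eq_single (hDN : ∀ i, D i * N i = τ i * N i) (hg : ∀ i, g i * ν i = τ i) (hν : ∀ i, IsUnit (ν i))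
    (hP : ∀ e : Finset ι, (∏ i ∈ e, (ν i - N i)) * (X e - Y e) = 0)
    (hLX : ∀ d U : Finset ι, U ⊆ d → (∏ i ∈ U, N i) * X d = PX U d * X (d \ U))
    (hLY : ∀ d U : Finset ι, U ⊆ d → (∏ i ∈ U, N i) * Y d = PY U d * Y (d \ U))
    (i : ι) :
    D i * (X {i} - Y {i}) = g i * ((PX {i} {i} - PY {i} {i}) * Y ∅) := by
  have h := prod_deriv_mul_sub_eq_sum N D ν τ g X Y PX PY hDN hg hν hP hLX hLY {i}
  rw [Finset.prod_singleton] at h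
  rw [h]
  have hpow : ({i} : Finset ι).powerset.erase ∅ = {{i}} := by
    ext U
    simp only [Finset.mem_erase, Finset.mem_powerset, Finset.subset_singleton_iff,
      Finset.mem_singleton]
    constructor
    · rintro ⟨hne, h | h⟩
      · exact absurd h hne
      · exact h
    · intro h
      exact ⟨by rw [h]; exact Finset.singleton_ne_empty i, Or.inr h⟩
  rw [hpow, Finset.sum_singleton, Finset.prod_singleton, Finset.sdiff_self, Finset.prod_empty,
    one_mul]

end EulerFactorComparison

end Summit.BirchSwinnertonDyer.Rank1Residual.GaloisImage
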